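import Summits.ValiantsHypothesis.ValiantsHypothesis.Theorems.GrenetZeonDualUnipotentThreeHalvesHeavyTopPencilFirstOrder

/-!
# `GrenetZeon.DualUnipotentThreeHalves` (stmt-ValiantsHypothesis-24318), R2 heavy-top instrument — the ENVELOPE `T` of a nilpotent space
# containing `A = J_n ⊕ 0` (Q1-PROOF §0): block-subdiagonal sums vanish, `B_{last,0} = 0`, `B_{n−1,last} = 0`

Experiment cell «val-heavytop-census» (D-0160), engine seat val-htc-eng-2 g3 (kernel-only lane; P-Q1 bricks, director-valiant R336 (5)).
§0 of the lead's pencil proof `lead-g2/Q1-PROOF.md` (Q1 «ι(7) ≤ 19»; crux copy `CENSUS-Q1-PROOF.md`), 0-based and size-free: on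
`Fin (n+1)` let `A = J_n ⊕ 0 = Σ_{i<n−1} E_{i,i+1}` (the block is `{0,…,n−1}`, the border index is `last = n`).  If a linear space
`V ∋ A` has `Z^n = 0` for all members then for every `B ∈ V` the first-order identity (✓ `HeavyTopPencilFirstOrder.firstOrder_eq_zero_of_mem`)
`L(B) := Σ_{a<n} A^a B A^{n−1−a} = 0` reads, entry by entry:

* `L(B)_{0, n−1−h} = σ_h(B) := Σ_{x−y=h, x<n} B_{x,y}` (the whole `h`-th block subdiagonal, `h < n`; `h = 0` is the block trace),
* `L(B)_{last, n−1} = B_{last, 0}`,  `L(B)_{0, last} = B_{n−1, last}`.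

So `V ⊆ T := {σ_h = 0 (h < n), B_{last,0} = 0, B_{n−1,last} = 0}` — Q1-PROOF's `T` (with `B_{last,last} = 0` from `tr B = 0` and `σ_0 = 0`).

* `shift_pow_apply` — `(A^a)_{q,x} = [x = q + a ∧ (a = 0 ∨ x < n)]`;
* `pow_mul_apply_of` / `pow_mul_apply_eq_zero`, `mul_pow_apply_of` / `mul_pow_apply_eq_zero` — entries of `A^a M` and `M A^b`;
* ★ `envelope_of_firstOrder` — from `L(B) = 0`: `B_{last,0} = 0`, `B_{n−1,last} = 0`, and `σ_h(B) = 0` for all `h < n`;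
* `envelope_of_mem` — the same for every member of a linear space `V ∋ A` on which `Z^n = 0`.

Honest framing: a lemma for the instrument's kernel port P-Q1 (§0); nothing here proves or refutes `HeavyTopLaw`/`HeavyTopSlowLaw`, 24318, S3 or 8062;
`VP ≠ VNP` is NOT proved.  No definitions.  [Q1-PROOF §0 (val-htc-lead g2); this seat]
-/

noncomputable section

-- single-conjunct layout: Sub = Summit, duplicated namespace component intended
set_option linter.dupNamespace false

namespace Summit.ValiantsHypothesis.ValiantsHypothesis.Theorems.GrenetZeon.HeavyTopBorderEnvelope

open Matrix
open Summit.ValiantsHypothesis.ValiantsHypothesis.Theorems.GrenetZeon.HeavyTopPencilFirstOrder (firstOrder_eq_zero_of_mem)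

variable {n : ℕ}

/-- Powers of `A = J_n ⊕ 0` on `Fin (n+1)`: `(A^a)_{q,x} = 1` iff `x = q + a` and (`a = 0` or `x` is a block index), else `0`. -/
theorem shift_pow_apply (A : Matrix (Fin (n + 1)) (Fin (n + 1)) ℂ)
    (hA : ∀ i j, A i j = if j.val = i.val + 1 ∧ j.val < n then 1 else 0) (a : ℕ) (q x : Fin (n + 1)) :
    (A ^ a) q x = if x.val = q.val + a ∧ (a = 0 ∨ x.val < n) then 1 else 0 := by
  induction a generalizing q x with
  | zero =>
    rw [pow_zero, Matrix.one_apply]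
    by_cases h : q = x
    · subst h; simp
    · have h' : ¬ (x.val = q.val + 0 ∧ (0 = 0 ∨ x.val < n)) := fun e => h (Fin.ext (by omega))
      rw [if_neg h, if_neg h']
  | succ a ih =>
    rw [pow_succ, Matrix.mul_apply]
    by_cases hx : 1 ≤ x.val
    · have hz : x.val - 1 < n + 1 := by have := x.isLt; omega
      rw [Finset.sum_eq_single ⟨x.val - 1, hz⟩]
      · rw [ih, hA]
        dsimp only
        by_cases h1 : x.val = q.val + (a + 1) ∧ (a + 1 = 0 ∨ x.val < n)
        · rw [if_pos h1, if_pos (by omega), if_pos (by omega), mul_one]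
        · rw [if_neg h1]
          by_cases h2 : x.val - 1 = q.val + a ∧ (a = 0 ∨ x.val - 1 < n)
          · rw [if_pos h2, if_neg (by omega), mul_zero]
          · rw [if_neg h2, zero_mul]
      · intro z _ hz'
        have hz'' : z.val ≠ x.val - 1 := fun e => hz' (Fin.ext (by simpa using e))
        rw [hA, if_neg (by omega), mul_zero]
      · intro h; exact absurd (Finset.mem_univ _) h
    · have hx0 : x.val = 0 := by omega
      rw [if_neg (by omega)]
      refine Finset.sum_eq_zero fun z _ => ?_
      rw [hA, if_neg (by omega), mul_zero]

/-- Entry of `A^a M`: row `q` of `A^a M` is row `q + a` of `M` (when that is a block row, or `a = 0`). -/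
theorem pow_mul_apply_of (A : Matrix (Fin (n + 1)) (Fin (n + 1)) ℂ)
    (hA : ∀ i j, A i j = if j.val = i.val + 1 ∧ j.val < n then 1 else 0) (a : ℕ) (M : Matrix (Fin (n + 1)) (Fin (n + 1)) ℂ)
    (q x y : Fin (n + 1)) (hx : x.val = q.val + a) (ha : a = 0 ∨ x.val < n) : (A ^ a * M) q y = M x y := by
  rw [Matrix.mul_apply, Finset.sum_eq_single x]
  · rw [shift_pow_apply A hA, if_pos ⟨hx, ha⟩, one_mul]
  · intro z _ hz
    have hz' : z.val ≠ x.val := fun e => hz (Fin.ext e)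
    rw [shift_pow_apply A hA, if_neg (by omega), zero_mul]
  · intro h; exact absurd (Finset.mem_univ _) h

/-- Entry of `A^a M` vanishes when row `q + a` is not available. -/
theorem pow_mul_apply_eq_zero (A : Matrix (Fin (n + 1)) (Fin (n + 1)) ℂ)
    (hA : ∀ i j, A i j = if j.val = i.val + 1 ∧ j.val < n then 1 else 0) (a : ℕ) (M : Matrix (Fin (n + 1)) (Fin (n + 1)) ℂ)
    (q y : Fin (n + 1)) (h : ¬ (q.val + a ≤ n ∧ (a = 0 ∨ q.val + a < n))) : (A ^ a * M) q y = 0 := by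
  rw [Matrix.mul_apply]
  refine Finset.sum_eq_zero fun z _ => ?_
  have hz := z.isLt
  rw [shift_pow_apply A hA, if_neg (by omega), zero_mul]

/-- Entry of `M A^b`: column `r` of `M A^b` is column `r − b` of `M` (when `r` is a block column, or `b = 0`). -/
theorem mul_pow_apply_of (A : Matrix (Fin (n + 1)) (Fin (n + 1)) ℂ)
    (hA : ∀ i j, A i j = if j.val = i.val + 1 ∧ j.val < n then 1 else 0) (b : ℕ) (M : Matrix (Fin (n + 1)) (Fin (n + 1)) ℂ)
    (q y r : Fin (n + 1)) (hy : r.val = y.val + b) (hb : b = 0 ∨ r.val < n) : (M * A ^ b) q r = M q y := by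
  rw [Matrix.mul_apply, Finset.sum_eq_single y]
  · rw [shift_pow_apply A hA, if_pos ⟨hy, hb⟩, mul_one]
  · intro z _ hz
    have hz' : z.val ≠ y.val := fun e => hz (Fin.ext e)
    rw [shift_pow_apply A hA, if_neg (by omega), mul_zero]
  · intro h; exact absurd (Finset.mem_univ _) h

/-- Entry of `M A^b` vanishes when column `r − b` is not available. -/
theorem mul_pow_apply_eq_zero (A : Matrix (Fin (n + 1)) (Fin (n + 1)) ℂ)
    (hA : ∀ i j, A i j = if j.val = i.val + 1 ∧ j.val < n then 1 else 0) (b : ℕ) (M : Matrix (Fin (n + 1)) (Fin (n + 1)) ℂ)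
    (q r : Fin (n + 1)) (h : ¬ (b ≤ r.val ∧ (b = 0 ∨ r.val < n))) : (M * A ^ b) q r = 0 := by
  rw [Matrix.mul_apply]
  refine Finset.sum_eq_zero fun z _ => ?_
  rw [shift_pow_apply A hA, if_neg (by omega), mul_zero]

/-- ★ **The envelope `T` (Q1-PROOF §0).**  If `L(B) = Σ_{a<n} A^a B A^{n−1−a} = 0` for `A = J_n ⊕ 0` on `Fin (n+1)`, then `B_{last,0} = 0`,
`B_{n−1,last} = 0`, and every block subdiagonal sum `σ_h(B) = Σ_{x<n, x ≥ h} B_{x, x−h}` (`h < n`) vanishes. [Q1-PROOF §0] -/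
theorem envelope_of_firstOrder (hn : 1 ≤ n) (A : Matrix (Fin (n + 1)) (Fin (n + 1)) ℂ)
    (hA : ∀ i j, A i j = if j.val = i.val + 1 ∧ j.val < n then 1 else 0) (B : Matrix (Fin (n + 1)) (Fin (n + 1)) ℂ)
    (hL : ∑ a ∈ Finset.range n, A ^ a * B * A ^ (n - 1 - a) = 0) :
    B (Fin.last n) 0 = 0 ∧ B ⟨n - 1, by omega⟩ (Fin.last n) = 0 ∧
      ∀ h : ℕ, h < n → ∑ x : Fin n, (if h ≤ x.val then B (Fin.castSucc x) ⟨x.val - h, by omega⟩ else 0) = 0 := by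
  have entry : ∀ q r : Fin (n + 1), ∑ a ∈ Finset.range n, (A ^ a * B * A ^ (n - 1 - a)) q r = 0 := by
    intro q r
    have e := congr_fun (congr_fun hL q) r
    rwa [Matrix.sum_apply] at e
  refine ⟨?_, ?_, ?_⟩
  · -- entry `(last, n-1)`: only `a = 0` survives
    have e := entry (Fin.last n) ⟨n - 1, by omega⟩
    rw [Finset.sum_eq_single 0] at e
    · rwa [pow_zero, Matrix.one_mul, mul_pow_apply_of A hA (n - 1 - 0) B (Fin.last n) 0 ⟨n - 1, by omega⟩
        (by simp) (Or.inr (by simp; omega))] at e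
    · intro a ha ha0
      rw [Finset.mem_range] at ha
      rw [mul_pow_apply_of A hA (n - 1 - a) (A ^ a * B) (Fin.last n) ⟨a, by omega⟩ ⟨n - 1, by omega⟩
        (by simp; omega) (Or.inr (by simp; omega))]
      exact pow_mul_apply_eq_zero A hA a B _ _ (by simp [Fin.val_last]; omega)
    · intro h; exact absurd (Finset.mem_range.2 (by omega)) h
  · -- entry `(0, last)`: only `a = n-1` survives
    have e := entry 0 (Fin.last n)
    rw [Finset.sum_eq_single (n - 1)] at e
    · rwa [mul_pow_apply_of A hA (n - 1 - (n - 1)) (A ^ (n - 1) * B) 0 (Fin.last n) (Fin.last n) (by simp) (Or.inl (by omega)),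
        pow_mul_apply_of A hA (n - 1) B 0 ⟨n - 1, by omega⟩ (Fin.last n) (by simp) (Or.inr (by simp; omega))] at e
    · intro a ha ha1
      rw [Finset.mem_range] at ha
      exact mul_pow_apply_eq_zero A hA (n - 1 - a) (A ^ a * B) 0 (Fin.last n) (by simp [Fin.val_last]; omega)
    · intro h; exact absurd (Finset.mem_range.2 (by omega)) h
  · -- entry `(0, n-1-h)`: the terms `a ≥ h` give the `h`-th block subdiagonal
    intro h hh
    have e := entry 0 ⟨n - 1 - h, by omega⟩
    have term : ∀ a ∈ Finset.range n, (A ^ a * B * A ^ (n - 1 - a)) 0 ⟨n - 1 - h, by omega⟩ =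
        if h ≤ a then (if ha : a < n then B ⟨a, by omega⟩ ⟨a - h, by omega⟩ else 0) else 0 := by
      intro a ha
      rw [Finset.mem_range] at ha
      by_cases hha : h ≤ a
      · rw [if_pos hha, dif_pos ha,
          mul_pow_apply_of A hA (n - 1 - a) (A ^ a * B) 0 ⟨a - h, by omega⟩ ⟨n - 1 - h, by omega⟩ (by simp; omega)
            (Or.inr (by simp; omega)),
          pow_mul_apply_of A hA a B 0 ⟨a, by omega⟩ ⟨a - h, by omega⟩ (by simp) (Or.inr (by simp; omega))]
      · rw [if_neg hha]
        exact mul_pow_apply_eq_zero A hA (n - 1 - a) (A ^ a * B) 0 _ (by simp; omega)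
    rw [Finset.sum_congr rfl term] at e
    have e' : (∑ x : Fin n, (if h ≤ x.val then B (Fin.castSucc x) ⟨x.val - h, by omega⟩ else 0)) =
        ∑ a ∈ Finset.range n, (if h ≤ a then (if ha : a < n then B ⟨a, by omega⟩ ⟨a - h, by omega⟩ else 0) else 0) := by
      rw [← Fin.sum_univ_eq_sum_range
        (fun a => if h ≤ a then (if ha : a < n then B ⟨a, by omega⟩ ⟨a - h, by omega⟩ else 0) else 0) n]
      refine Finset.sum_congr rfl fun x _ => ?_
      by_cases hhx : h ≤ x.val
      · rw [if_pos hhx, if_pos hhx, dif_pos x.isLt]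
        rfl
      · rw [if_neg hhx, if_neg hhx]
    rw [e', e]

/-- **The envelope in a nilpotent space (Q1-PROOF §0).**  If every member `Z` of the linear space `V ≤ M_{n+1}(ℂ)` has `Z^n = 0` and
`A = J_n ⊕ 0 ∈ V`, then every `B ∈ V` has `B_{last,0} = 0`, `B_{n−1,last} = 0` and all block subdiagonal sums `σ_h(B) = 0` (`h < n`). -/
theorem envelope_of_mem (hn : 1 ≤ n) (V : Submodule ℂ (Matrix (Fin (n + 1)) (Fin (n + 1)) ℂ)) (hV : ∀ Z ∈ V, Z ^ n = 0)
    (A : Matrix (Fin (n + 1)) (Fin (n + 1)) ℂ) (hA : ∀ i j, A i j = if j.val = i.val + 1 ∧ j.val < n then 1 else 0) (hAV : A ∈ V)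
    (B : Matrix (Fin (n + 1)) (Fin (n + 1)) ℂ) (hB : B ∈ V) :
    B (Fin.last n) 0 = 0 ∧ B ⟨n - 1, by omega⟩ (Fin.last n) = 0 ∧
      ∀ h : ℕ, h < n → ∑ x : Fin n, (if h ≤ x.val then B (Fin.castSucc x) ⟨x.val - h, by omega⟩ else 0) = 0 :=
  envelope_of_firstOrder hn A hA B (firstOrder_eq_zero_of_mem V n hV hAV hB)

end Summit.ValiantsHypothesis.ValiantsHypothesis.Theorems.GrenetZeon.HeavyTopBorderEnvelope

end
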